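import Mathlib
import HarnessLib

/-!
# Powers of the maximal ideal of `K⟦x₁,…,xₙ⟧` are the jets: `f ∈ 𝔪ᴺ ↔ ord f ≥ N`;
# every `K`-algebra endomorphism is a substitution

`Literature/RingTheory/MvPowerSeries/MaximalIdealPow.lean`, grouping namespace
`Literature.RingTheory.MvPowerSeries.Jets` (the objects are the jet ideals `𝔪 ^ N`; the bare names
`monomial_mem_maximalIdeal_pow` etc. are taken in this directory by the CONVERGENT-series versions of
`ConvergentClosedIdeals.lean`). Everything here is PROVED (no definition, no named fact). For a field `K` and finitely many variables `σ`, the maximal ideal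
`𝔪` of the local ring `R = MvPowerSeries σ K` satisfies

* `mem_maximalIdeal_pow_iff` : `f ∈ 𝔪 ^ N ↔ ∀ e, e.degree < N → coeff e f = 0`
  (equivalently `le_order_iff_mem_maximalIdeal_pow` : `↑N ≤ f.order ↔ f ∈ 𝔪 ^ N`); the two
  directions are `coeff_eq_zero_of_mem_maximalIdeal_pow` and
  `mem_maximalIdeal_pow_of_coeff_eq_zero`;
* `monomial_mem_maximalIdeal_pow`, `maximalIdeal_pow_eq_span_monomial` : `𝔪 ^ N` is generated
  by the monomials of degree `N`;
* `sub_coe_truncTotal_mem_maximalIdeal_pow` : `f ≡ truncTotal N f (mod 𝔪 ^ N)` (jets);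
* for a `K`-algebra ENDOmorphism `φ` of `R`: `constantCoeff_algHom_X`,
  `algHom_apply_mem_maximalIdeal_pow` (`φ` is local and `𝔪`-adically contracting),
  `algHom_apply_eq_subst` (`φ f = MvPowerSeries.subst (fun s ↦ φ (X s)) f` — every `K`-algebra
  endomorphism is the substitution of its values on the variables) and `algHom_ext_X`.

These are the standard facts "the `𝔪`-adic filtration of `K⟦x⟧` is the order filtration" and
"`Hom_{K-alg}(K⟦x⟧, K⟦x⟧) = 𝔪ⁿ` via `φ ↦ (φ(xᵢ))ᵢ`" (e.g. Greuel–Lossen–Shustin, *Introduction to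
Singularities and Deformations*, Springer 2007, Lemma I.1.6 p. 106 and §I.1.2; Matsumura,
*Commutative Ring Theory*, §1 Ex. 8.6/8.8 for formal power series rings). The decomposition
behind the non-trivial direction (`exists_eq_sum_monomial_mul` : a series of order `≥ N` is a
FINITE combination `∑_{|e| = N} xᵉ · gₑ`) fixes, for every exponent `d` of degree `≥ N`, one
`e ≤ d` of degree `N` (`exists_le_degree_eq`).

Consumers: the stubs of crux `FrobeniusClosing.ClosingReduction` of summit
`ResolutionOfSingularities` (finite determinacy transfer, pair-isomorphism kit, chart
factorization, Loewy bound), which need jets of cleaned series and the substitution form of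
automorphisms of `K⟦u⟧`.

## References

* [GreuelLossenShustin2007] G.-M. Greuel, C. Lossen, E. Shustin, Introduction to Singularities
  and Deformations, Springer 2007, §I.1.
* [Matsumura1986] H. Matsumura, Commutative Ring Theory, CUP 1986, §1, §8.
-/

noncomputable section

open MvPowerSeries Finsupp IsLocalRing

namespace Literature.RingTheory.MvPowerSeries.Jets

variable {σ : Type*} {K : Type*} [Field K]

/-! ### 1. `𝔪 ^ N` only contains series of order `≥ N` -/

/-- Membership in the maximal ideal of `K⟦x⟧` is vanishing of the constant coefficient.
[folklore] -/
theorem mem_maximalIdeal_iff_constantCoeff_eq_zero {f : MvPowerSeries σ K} :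
    f ∈ maximalIdeal (MvPowerSeries σ K) ↔ constantCoeff f = 0 := by
  rw [IsLocalRing.mem_maximalIdeal, mem_nonunits_iff, MvPowerSeries.isUnit_iff_constantCoeff,
    isUnit_iff_ne_zero, not_not]

/-- Membership in the maximal ideal of `K⟦x⟧` is `1 ≤ order`. [folklore] -/
theorem mem_maximalIdeal_iff_one_le_order {f : MvPowerSeries σ K} :
    f ∈ maximalIdeal (MvPowerSeries σ K) ↔ (1 : ℕ∞) ≤ f.order := by
  rw [mem_maximalIdeal_iff_constantCoeff_eq_zero, one_le_order_iff_constCoeff_eq_zero]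

/-- Elements of `𝔪 ^ N` have order `≥ N`. [folklore] -/
theorem le_order_of_mem_maximalIdeal_pow {N : ℕ} {f : MvPowerSeries σ K}
    (h : f ∈ maximalIdeal (MvPowerSeries σ K) ^ N) : (N : ℕ∞) ≤ f.order := by
  induction N generalizing f with
  | zero => simp
  | succ N ih =>
    rw [pow_succ] at h
    refine Submodule.mul_induction_on h (fun g hg k hk => ?_) (fun x y hx hy => ?_)
    · calc ((N + 1 : ℕ) : ℕ∞) = (N : ℕ∞) + 1 := by push_cast; rfl
        _ ≤ g.order + k.order := add_le_add (ih hg) (mem_maximalIdeal_iff_one_le_order.1 hk)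
        _ ≤ (g * k).order := le_order_mul
    · exact le_trans (le_min hx hy) min_order_le_add

/-- Elements of `𝔪 ^ N` have no coefficients in degree `< N`. [folklore] -/
theorem coeff_eq_zero_of_mem_maximalIdeal_pow {N : ℕ} {f : MvPowerSeries σ K}
    (h : f ∈ maximalIdeal (MvPowerSeries σ K) ^ N) {e : σ →₀ ℕ} (he : e.degree < N) :
    coeff e f = 0 :=
  coeff_of_lt_order (lt_of_lt_of_le (by exact_mod_cast he) (le_order_of_mem_maximalIdeal_pow h))

/-! ### 2. Monomials of degree `≥ N` lie in `𝔪 ^ N` -/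

/-- `monomial e a ∈ 𝔪 ^ N` whenever `N ≤ |e|`. [folklore] -/
theorem monomial_mem_maximalIdeal_pow {e : σ →₀ ℕ} {N : ℕ} (h : N ≤ e.degree) (a : K) :
    monomial e a ∈ maximalIdeal (MvPowerSeries σ K) ^ N := by
  classical
  -- reduce to `a = 1` and `N = |e|`
  suffices key : ∀ (M : ℕ) (d : σ →₀ ℕ), d.degree = M →
      monomial d (1 : K) ∈ maximalIdeal (MvPowerSeries σ K) ^ M by
    have h1 : monomial e a = C a * monomial e (1 : K) := by
      rw [← monomial_zero_eq_C_apply, monomial_mul_monomial, zero_add, mul_one]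
    rw [h1]
    exact Ideal.mul_mem_left _ _ (Ideal.pow_le_pow_right h (key e.degree e rfl))
  intro M
  induction M with
  | zero => intro d _; simp
  | succ M ih =>
    intro d hd
    have hd0 : d ≠ 0 := by
      intro h0; rw [h0, map_zero] at hd; exact Nat.succ_ne_zero M hd.symm
    obtain ⟨i, hi⟩ : ∃ i, d i ≠ 0 := by
      by_contra hne
      push Not at hne
      exact hd0 (Finsupp.ext hne)
    -- `d = d' + single i 1`
    set d' : σ →₀ ℕ := d - single i 1 with hd'
    have hdd : d = d' + single i 1 := by
      ext j
      simp only [hd', Finsupp.coe_add, Finsupp.coe_tsub, Pi.add_apply, Pi.sub_apply,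
        Finsupp.single_apply]
      split_ifs with hij
      · subst hij; omega
      · omega
    have hdeg : d'.degree = M := by
      have := congrArg Finsupp.degree hdd
      rw [map_add, degree_single, hd] at this
      omega
    rw [hdd, ← mul_one (1 : K), ← monomial_mul_monomial, pow_succ]
    refine Ideal.mul_mem_mul (ih d' hdeg) ?_
    rw [← X_def]
    exact mem_maximalIdeal_iff_constantCoeff_eq_zero.2 (constantCoeff_X i)

/-- Below every exponent of degree `≥ N` there is one of degree exactly `N`. [folklore] -/
theorem exists_le_degree_eq (N : ℕ) (d : σ →₀ ℕ) (h : N ≤ d.degree) :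
    ∃ e : σ →₀ ℕ, e ≤ d ∧ e.degree = N := by
  classical
  induction N with
  | zero => exact ⟨0, by simp, by simp⟩
  | succ N ih =>
    obtain ⟨e, hed, he⟩ := ih (Nat.le_of_succ_le h)
    have hne : e ≠ d := by
      rintro rfl; omega
    obtain ⟨i, hi⟩ : ∃ i, e i < d i := by
      by_contra hcon
      push Not at hcon
      exact hne (le_antisymm hed fun j => hcon j)
    refine ⟨e + single i 1, ?_, by rw [map_add, degree_single, he]⟩
    intro j
    simp only [Finsupp.coe_add, Pi.add_apply, Finsupp.single_apply]
    split_ifs with hij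
    · subst hij; omega
    · simpa using hed j

/-! ### 3. A series of order `≥ N` is a finite combination of monomials of degree `N` -/

section Finite

variable [Finite σ]

/-- **Decomposition.** If every coefficient of `f` in degree `< N` vanishes, then
`f = ∑_{|e| = N} xᵉ · g e` for some family `g` indexed by the finitely many exponents of
degree `N`. [folklore] -/
theorem exists_eq_sum_monomial_mul (N : ℕ) (f : MvPowerSeries σ K)
    (hf : ∀ e : σ →₀ ℕ, e.degree < N → coeff e f = 0) :
    ∃ (S : Finset (σ →₀ ℕ)) (g : (σ →₀ ℕ) → MvPowerSeries σ K),
      (∀ e ∈ S, e.degree = N) ∧ f = ∑ e ∈ S, monomial e (1 : K) * g e := by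
  classical
  -- a choice of prefix `pref d ≤ d` of degree `N` for every `d` of degree `≥ N`
  have hch : ∀ d : σ →₀ ℕ, ∃ e : σ →₀ ℕ, N ≤ d.degree → e ≤ d ∧ e.degree = N := by
    intro d
    by_cases hd : N ≤ d.degree
    · obtain ⟨e, he⟩ := exists_le_degree_eq N d hd
      exact ⟨e, fun _ => he⟩
    · exact ⟨0, fun h => (hd h).elim⟩
  choose pref hpref using hch
  -- the finitely many exponents of degree `N`
  let S : Finset (σ →₀ ℕ) := (finite_of_degree_le N).toFinset.filter fun e => e.degree = N
  have hS : ∀ e, e ∈ S ↔ e.degree = N := by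
    intro e
    simp only [S, Finset.mem_filter, Set.Finite.mem_toFinset, Set.mem_setOf_eq]
    exact ⟨fun h => h.2, fun h => ⟨h.le, h⟩⟩
  let g : (σ →₀ ℕ) → MvPowerSeries σ K := fun e d' =>
    if pref (e + d') = e then coeff (e + d') f else 0
  refine ⟨S, g, fun e he => (hS e).1 he, ?_⟩
  ext d
  rw [map_sum]
  simp only [coeff_monomial_mul, one_mul]
  have hg : ∀ e d' : σ →₀ ℕ, coeff d' (g e) = if pref (e + d') = e then coeff (e + d') f else 0 :=
    fun _ _ => rfl
  by_cases hd : N ≤ d.degree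
  · -- exactly the term `e = pref d` survives
    obtain ⟨hle, hdeg⟩ := hpref d hd
    rw [Finset.sum_eq_single (pref d)]
    · rw [if_pos hle, hg, add_tsub_cancel_of_le hle, if_pos rfl]
    · intro e _ hne
      split_ifs with hed
      · rw [hg, add_tsub_cancel_of_le hed, if_neg (Ne.symm hne)]
      · rfl
    · intro hnot
      exact (hnot ((hS _).2 hdeg)).elim
  · -- degree `d < N`: no `e ∈ S` is below `d`, and `coeff d f = 0`
    push Not at hd
    rw [hf d hd, eq_comm]
    refine Finset.sum_eq_zero fun e he => ?_
    rw [if_neg]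
    intro hed
    have := Finsupp.degree_mono hed
    rw [(hS e).1 he] at this
    omega

/-- **Jets.** If every coefficient of `f` in degree `< N` vanishes then `f ∈ 𝔪 ^ N`.
[folklore] -/
theorem mem_maximalIdeal_pow_of_coeff_eq_zero {N : ℕ} {f : MvPowerSeries σ K}
    (h : ∀ e : σ →₀ ℕ, e.degree < N → coeff e f = 0) :
    f ∈ maximalIdeal (MvPowerSeries σ K) ^ N := by
  obtain ⟨S, g, hS, rfl⟩ := exists_eq_sum_monomial_mul N f h
  exact Ideal.sum_mem _ fun e he =>
    Ideal.mul_mem_right _ _ (monomial_mem_maximalIdeal_pow (hS e he).ge 1)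

/-- `f ∈ 𝔪 ^ N ↔` all coefficients of degree `< N` vanish. [folklore] -/
theorem mem_maximalIdeal_pow_iff {N : ℕ} {f : MvPowerSeries σ K} :
    f ∈ maximalIdeal (MvPowerSeries σ K) ^ N ↔ ∀ e : σ →₀ ℕ, e.degree < N → coeff e f = 0 :=
  ⟨fun h _ he => coeff_eq_zero_of_mem_maximalIdeal_pow h he, mem_maximalIdeal_pow_of_coeff_eq_zero⟩

/-- Series of order `≥ N` form exactly `𝔪 ^ N`. [folklore] -/
theorem mem_maximalIdeal_pow_of_le_order {N : ℕ} {f : MvPowerSeries σ K} (h : (N : ℕ∞) ≤ f.order) :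
    f ∈ maximalIdeal (MvPowerSeries σ K) ^ N :=
  mem_maximalIdeal_pow_of_coeff_eq_zero fun _ he =>
    coeff_of_lt_order (lt_of_lt_of_le (by exact_mod_cast he) h)

/-- `↑N ≤ order f ↔ f ∈ 𝔪 ^ N`. [folklore] -/
theorem le_order_iff_mem_maximalIdeal_pow {N : ℕ} {f : MvPowerSeries σ K} :
    (N : ℕ∞) ≤ f.order ↔ f ∈ maximalIdeal (MvPowerSeries σ K) ^ N :=
  ⟨mem_maximalIdeal_pow_of_le_order, le_order_of_mem_maximalIdeal_pow⟩

/-- `𝔪 ^ N` is generated by the monomials of degree `N`. [folklore] -/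
theorem maximalIdeal_pow_eq_span_monomial (N : ℕ) :
    maximalIdeal (MvPowerSeries σ K) ^ N =
      Ideal.span ((fun e : σ →₀ ℕ => monomial e (1 : K)) '' {e | e.degree = N}) := by
  apply le_antisymm
  · intro f hf
    obtain ⟨S, g, hS, rfl⟩ := exists_eq_sum_monomial_mul N f
      (fun e he => coeff_eq_zero_of_mem_maximalIdeal_pow hf he)
    exact Ideal.sum_mem _ fun e he =>
      Ideal.mul_mem_right _ _ (Ideal.subset_span ⟨e, hS e he, rfl⟩)
  · rw [Ideal.span_le]
    rintro _ ⟨e, he, rfl⟩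
    exact monomial_mem_maximalIdeal_pow (le_of_eq he.symm) 1

/-- **Jets, truncated form.** `f ≡ truncTotal N f (mod 𝔪 ^ N)`. [folklore] -/
theorem sub_coe_truncTotal_mem_maximalIdeal_pow (N : ℕ) (f : MvPowerSeries σ K) :
    f - ↑(truncTotal N f) ∈ maximalIdeal (MvPowerSeries σ K) ^ N := by
  refine mem_maximalIdeal_pow_of_coeff_eq_zero fun e he => ?_
  rw [map_sub, MvPolynomial.coeff_coe, coeff_truncTotal _ he, sub_self]

/-- The quotient `K⟦x⟧ ⧸ 𝔪 ^ N` (the `(N-1)`-jets) is spanned over `K` by the images of the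
monomials of degree `< N`; in particular it is finite-dimensional. [folklore] -/
theorem span_monomial_quotient_maximalIdeal_pow_eq_top (N : ℕ) :
    Submodule.span K ((fun e : σ →₀ ℕ =>
        Ideal.Quotient.mk (maximalIdeal (MvPowerSeries σ K) ^ N) (monomial e (1 : K))) ''
        {e | e.degree < N}) = ⊤ := by
  classical
  rw [eq_top_iff]
  rintro x -
  obtain ⟨f, rfl⟩ := Ideal.Quotient.mk_surjective x
  have hf : Ideal.Quotient.mk (maximalIdeal (MvPowerSeries σ K) ^ N) f =
      Ideal.Quotient.mk _ (↑(truncTotal N f) : MvPowerSeries σ K) := by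
    rw [Ideal.Quotient.eq]
    exact sub_coe_truncTotal_mem_maximalIdeal_pow N f
  -- each monomial term of the truncation lands in the span
  have hterm : ∀ (v : σ →₀ ℕ) (c : K),
      Ideal.Quotient.mk (maximalIdeal (MvPowerSeries σ K) ^ N) (monomial v c) =
        c • Ideal.Quotient.mk (maximalIdeal (MvPowerSeries σ K) ^ N) (monomial v (1 : K)) := by
    intro v c
    rw [Algebra.smul_def, ← Ideal.Quotient.mk_algebraMap, ← map_mul, MvPowerSeries.algebraMap_apply,
      Algebra.algebraMap_self, RingHom.id_apply, ← monomial_zero_eq_C_apply, monomial_mul_monomial,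
      zero_add, mul_one]
  rw [hf, (truncTotal N f).as_sum, ← MvPolynomial.coeToMvPowerSeries.ringHom_apply, map_sum, map_sum]
  refine Submodule.sum_mem _ fun e he => ?_
  rw [MvPolynomial.coeToMvPowerSeries.ringHom_apply, MvPolynomial.coe_monomial, hterm]
  refine Submodule.smul_mem _ _ (Submodule.subset_span ⟨e, ?_, rfl⟩)
  -- `e` is in the support of the truncation, hence of degree `< N`
  by_contra hN
  simp only [Set.mem_setOf_eq, not_lt] at hN
  exact (MvPolynomial.mem_support_iff.1 he) (coeff_truncTotal_eq_zero _ hN)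

/-- `K⟦x⟧ ⧸ 𝔪 ^ N` is a finite-dimensional `K`-vector space. [folklore] -/
theorem finite_quotient_maximalIdeal_pow (N : ℕ) :
    Module.Finite K (MvPowerSeries σ K ⧸ maximalIdeal (MvPowerSeries σ K) ^ N) := by
  refine ⟨Submodule.fg_def.2 ⟨_, ?_, span_monomial_quotient_maximalIdeal_pow_eq_top N⟩⟩
  exact (finite_of_degree_lt N).image _

end Finite

/-! ### 4. `K`-algebra endomorphisms of `K⟦x⟧` are local and are substitutions -/

/-- A `K`-algebra endomorphism fixes the constants `C c`. [folklore] -/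
theorem algHom_C (φ : MvPowerSeries σ K →ₐ[K] MvPowerSeries σ K) (c : K) : φ (C c) = C c := by
  rw [MvPowerSeries.c_eq_algebraMap]
  exact φ.commutes c

/-- A `K`-algebra endomorphism of `K⟦x⟧` is local: it maps `𝔪` into `𝔪`. (If `φ f` had constant
coefficient `c ≠ 0` for some `f ∈ 𝔪`, then `f - C c` is a unit but `φ (f - C c) = φ f - C c`
is not.) [folklore] -/
theorem algHom_apply_mem_maximalIdeal (φ : MvPowerSeries σ K →ₐ[K] MvPowerSeries σ K)
    {f : MvPowerSeries σ K} (hf : f ∈ maximalIdeal (MvPowerSeries σ K)) :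
    φ f ∈ maximalIdeal (MvPowerSeries σ K) := by
  rw [mem_maximalIdeal_iff_constantCoeff_eq_zero] at hf ⊢
  by_contra hc
  have hu : IsUnit (f - C (constantCoeff (φ f))) := by
    rw [MvPowerSeries.isUnit_iff_constantCoeff, map_sub, hf, constantCoeff_C, zero_sub,
      isUnit_iff_ne_zero, neg_ne_zero]
    exact hc
  have hnu : ¬ IsUnit (φ (f - C (constantCoeff (φ f)))) := by
    rw [map_sub, algHom_C, MvPowerSeries.isUnit_iff_constantCoeff, map_sub, constantCoeff_C,
      sub_self]
    exact not_isUnit_zero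
  exact hnu (hu.map φ)

/-- The values of a `K`-algebra endomorphism on the variables have no constant term.
[folklore] -/
theorem constantCoeff_algHom_X (φ : MvPowerSeries σ K →ₐ[K] MvPowerSeries σ K) (s : σ) :
    constantCoeff (φ (X s)) = 0 :=
  mem_maximalIdeal_iff_constantCoeff_eq_zero.1
    (algHom_apply_mem_maximalIdeal φ (mem_maximalIdeal_iff_constantCoeff_eq_zero.2 (constantCoeff_X s)))

/-- A `K`-algebra endomorphism maps `𝔪 ^ N` into `𝔪 ^ N`. [folklore] -/
theorem algHom_apply_mem_maximalIdeal_pow (φ : MvPowerSeries σ K →ₐ[K] MvPowerSeries σ K)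
    {N : ℕ} {f : MvPowerSeries σ K} (hf : f ∈ maximalIdeal (MvPowerSeries σ K) ^ N) :
    φ f ∈ maximalIdeal (MvPowerSeries σ K) ^ N := by
  have hle : (maximalIdeal (MvPowerSeries σ K) ^ N).map (φ : MvPowerSeries σ K →+* MvPowerSeries σ K) ≤
      maximalIdeal (MvPowerSeries σ K) ^ N := by
    rw [Ideal.map_pow]
    refine Ideal.pow_right_mono ?_ N
    rw [Ideal.map_le_iff_le_comap]
    intro g hg
    exact algHom_apply_mem_maximalIdeal φ hg
  exact hle (Ideal.mem_map_of_mem _ hf)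

section Finite

variable [Finite σ]

/-- The family `(φ (X s))_s` is substitutable (zero constant coefficients). [folklore] -/
theorem hasSubst_algHom_X (φ : MvPowerSeries σ K →ₐ[K] MvPowerSeries σ K) :
    HasSubst (fun s => φ (X s)) :=
  hasSubst_of_constantCoeff_zero fun s => constantCoeff_algHom_X φ s

/-- Two `K`-algebra endomorphisms of `K⟦x⟧` that agree on polynomials agree modulo every power of
`𝔪`, hence are equal. [folklore] -/
theorem algHom_ext_coe {φ ψ : MvPowerSeries σ K →ₐ[K] MvPowerSeries σ K}
    (h : ∀ q : MvPolynomial σ K, φ (↑q) = ψ (↑q)) : φ = ψ := by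
  ext f e
  -- compare modulo `𝔪 ^ (|e| + 1)`
  have hmem : φ f - ψ f ∈ maximalIdeal (MvPowerSeries σ K) ^ (e.degree + 1) := by
    have hsplit : f = ↑(truncTotal (e.degree + 1) f) + (f - ↑(truncTotal (e.degree + 1) f)) := by
      ring
    rw [hsplit, map_add, map_add, h, add_sub_add_left_eq_sub]
    exact Ideal.sub_mem _ (algHom_apply_mem_maximalIdeal_pow φ (sub_coe_truncTotal_mem_maximalIdeal_pow _ f))
      (algHom_apply_mem_maximalIdeal_pow ψ (sub_coe_truncTotal_mem_maximalIdeal_pow _ f))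
  have := coeff_eq_zero_of_mem_maximalIdeal_pow hmem (Nat.lt_succ_self e.degree)
  rwa [map_sub, sub_eq_zero] at this

/-- Two `K`-algebra endomorphisms of `K⟦x⟧` agreeing on the variables are equal. [folklore] -/
theorem algHom_ext_X {φ ψ : MvPowerSeries σ K →ₐ[K] MvPowerSeries σ K}
    (h : ∀ s, φ (X s) = ψ (X s)) : φ = ψ := by
  apply algHom_ext_coe
  intro q
  -- restrict to polynomials: two algebra maps out of `MvPolynomial` agreeing on the variables
  have key : (φ.comp (MvPolynomial.coeToMvPowerSeries.algHom K)) =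
      (ψ.comp (MvPolynomial.coeToMvPowerSeries.algHom K)) := by
    apply MvPolynomial.algHom_ext
    intro s
    simp only [AlgHom.coe_comp, Function.comp_apply, MvPolynomial.coeToMvPowerSeries.algHom_apply,
      Algebra.algebraMap_self, MvPowerSeries.map_id, MvPolynomial.coe_X, RingHom.id_apply]
    exact h s
  have := congrArg (fun χ => χ q) key
  simpa only [AlgHom.coe_comp, Function.comp_apply, MvPolynomial.coeToMvPowerSeries.algHom_apply,
    Algebra.algebraMap_self, MvPowerSeries.map_id, RingHom.id_apply] using this

/-- **Every `K`-algebra endomorphism of `K⟦x⟧` is a substitution**: `φ f = f(φ x₁, …, φ xₙ)`.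
[folklore] -/
theorem algHom_apply_eq_subst (φ : MvPowerSeries σ K →ₐ[K] MvPowerSeries σ K) (f : MvPowerSeries σ K) :
    φ f = subst (fun s => φ (X s)) f := by
  have h : φ = substAlgHom (hasSubst_algHom_X φ) := by
    apply algHom_ext_X
    intro s
    rw [substAlgHom_apply, subst_X (hasSubst_algHom_X φ)]
  conv_lhs => rw [h]
  rw [substAlgHom_apply]

end Finite

end Literature.RingTheory.MvPowerSeries.Jets

end
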